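import Mathlib
import HarnessLib
import Literature.AlgebraicGeometry.Ramification.InertiaNormalSylow
import Literature.AlgebraicGeometry.Resolution.AugmentationIdeal
import Literature.AlgebraicGeometry.Resolution.StalkIdealLemmas
import Summits.ResolutionOfSingularities.ResolutionOfSingularities.Theorems.WildQuotientsWildQuotientResolutionTameFixedLocusBoundary
import Summits.ResolutionOfSingularities.ResolutionOfSingularities.Theorems.WildQuotientsWildQuotientResolutionStandardFormTransport

/-!
# Persistence of the standard-form hypothesis through a UNION of boundary divisors, and the character dichotomy
# (crux `WildQuotients.WildQuotientResolution`, stub `stub_phaseZeroHighDim`; any dimension)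

Crux stmt-ResolutionOfSingularities-15640 (`WildQuotientResolution`), registered stub `stub_phaseZeroHighDim`.
Two bookkeeping facts for MULTI-move p-standardisation (the next all-dimensional slices after
✓`PrimeCorePhaseZero` p822058 / ✓`TameCorePhaseZero`: several tame moves along `G`-stable centres
`Z_{M₁}, Z_{M₂}, …`, e.g. along `Z_{C_ℓ}` for the primes `ℓ` dividing the order of a cyclic normal `p′`-core):

* PERSISTENCE THROUGH A UNION (`stalkIdeal_le_augIdeal_or_of_subset_union`, `mem_augIdeal_or_of_subset_union`,
  and the relative form `…_of_preimage_subset_union` along an equivariant `π`): if the inert locus `Z_⟨g⟩` of a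
  tame `g ∈ I_x` (regular stalk) lies in `A ∪ B` for closed sets `A, B` — e.g. the preimage of an old boundary
  divisor is the union of the supports of its strict transform and of the new exceptional divisor — then the germ
  of `Z_⟨g⟩` at `x` lies in `A` or in `B`: `I(A)_x ≤ 𝔞_{τ g}` or `I(B)_x ≤ 𝔞_{τ g}` (`𝔞_{τ g}` is PRIME,
  ✓`isPrime_augIdeal`; `I(A ∪ B) = I(A) ⊓ I(B)`); with principal stalks `(a)`, `(b)` one of `a, b` lies in
  `𝔞_{τ g}` — the fixed-locus hypothesis of the criterion survives the move with the new boundary.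
* CHARACTER DICHOTOMY (`sub_mem_sq_or_mem_iSup_augIdeal`): if a boundary equation `z ∈ 𝔪` spans a line stable
  under a subgroup `K` ON THE NOSE (`τ g z ∈ (z)`, ✓`StandardFormStableLines.apply_mem_stalkIdeal_vanishingIdeal`),
  then either `K` acts on `κ z̄` trivially to first order (`τ g z − z ∈ 𝔪²` for all `g ∈ K` — the transversal
  case of ✓`TameFixedLocus.exists_isRsopPart_append` p817967) or `z` lies in the fixed-locus ideal `⨆ 𝔞_{τ g}`
  of `K` (✓`mem_augIdeal_of_apply_eq_mul`: the centre `Z_K` lies INSIDE the divisor `z = 0`) — the two ways a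
  tame centre has simple normal crossings with a stable boundary divisor.

[OURS · crux stmt-ResolutionOfSingularities-15640 · helper toward `stub_phaseZeroHighDim` (bookkeeping of the
standard-form route; NOT a proof of the stub); folklore, counted 0; AI-level work, weaker than expert review.]
[folklore]
-/

-- single-problem summit: the doubled namespace component `ResolutionOfSingularities` is forced
set_option linter.dupNamespace false

noncomputable section

open CategoryTheory AlgebraicGeometry TopologicalSpace IsLocalRing
open Literature.AlgebraicGeometry.Resolution Literature.AlgebraicGeometry.Ramification
open Scheme.IdealSheafData
open Summit.ResolutionOfSingularities.ResolutionOfSingularities.Theorems.WildQuotientResolution.PointBlowupStalkData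
open Summit.ResolutionOfSingularities.ResolutionOfSingularities.Theorems.WildQuotientResolution.InertLocusStalk

namespace Summit.ResolutionOfSingularities.ResolutionOfSingularities.Theorems.WildQuotientResolution.StandardForm

/-! ## Persistence through a union -/

section Union

variable {X : Scheme.{0}} {G : Type} [Group G] [Finite G] (σ : G →* Aut X) (p : ℕ) [Fact p.Prime]
  (x : X) [IsRegularLocalRing (X.presheaf.stalk x)] [CharP (ResidueField (X.presheaf.stalk x)) p]
  {I : Subgroup G} (a : I → (X.presheaf.stalk x ⟶ X.presheaf.stalk x))
  (τ : I →* (X.presheaf.stalk x ≃+* X.presheaf.stalk x))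
  (hkey : ∀ g : I, Spec.map (a g) ≫ X.fromSpecStalk x = X.fromSpecStalk x ≫ (σ (g : G)).hom)
  (hτ : ∀ (g : I) (r : X.presheaf.stalk x), τ g r = (a g⁻¹).hom r)

include hkey hτ

/-- **The germ of a tame inert locus inside a union of two closed sets lies in one of them**: if
`Z_⟨g⟩ ⊆ A ∪ B` (`g ∈ I_x` tame, regular stalk) then `I(A)_x ≤ 𝔞_{τ g}` or `I(B)_x ≤ 𝔞_{τ g}`. [folklore] -/
theorem stalkIdeal_le_augIdeal_or_of_subset_union (g : I) (hg : (orderOf g).Coprime p)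
    (hgx : (g : G) ∈ inertiaSubgroup σ x)
    (hZ : IsClosed {y : X | Subgroup.zpowers (g : G) ≤ inertiaSubgroup σ y}) (A B : Closeds X)
    (hAB : {y : X | Subgroup.zpowers (g : G) ≤ inertiaSubgroup σ y} ⊆ (A : Set X) ∪ B) :
    stalkIdeal (vanishingIdeal A) x ≤ augIdeal (τ g) ∨ stalkIdeal (vanishingIdeal B) x ≤ augIdeal (τ g) := by
  have hprime := isPrime_augIdeal σ p x a τ hkey hτ g hg hgx
  rw [← hprime.inf_le, ← stalkIdeal_inf, ← vanishingIdeal_sup]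
  intro z hz
  have hle : (⟨{y : X | Subgroup.zpowers (g : G) ≤ inertiaSubgroup σ y}, hZ⟩ : Closeds X) ≤ A ⊔ B :=
    fun y hy => hAB hy
  exact mem_augIdeal_of_mem_stalkIdeal_inertLocus σ p x a τ hkey hτ g hg hgx hZ
    (stalkIdeal_mono (vanishingIdeal_antimono hle) x hz)

/-- **Principal form**: if moreover `I(A)_x = (a₀)` and `I(B)_x = (b₀)` (two boundary divisors through `x`), then
`a₀ ∈ 𝔞_{τ g}` or `b₀ ∈ 𝔞_{τ g}`. [folklore] -/
theorem mem_augIdeal_or_of_subset_union (g : I) (hg : (orderOf g).Coprime p)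
    (hgx : (g : G) ∈ inertiaSubgroup σ x)
    (hZ : IsClosed {y : X | Subgroup.zpowers (g : G) ≤ inertiaSubgroup σ y}) (A B : Closeds X)
    (hAB : {y : X | Subgroup.zpowers (g : G) ≤ inertiaSubgroup σ y} ⊆ (A : Set X) ∪ B)
    {a₀ b₀ : X.presheaf.stalk x} (ha : stalkIdeal (vanishingIdeal A) x = Ideal.span {a₀})
    (hb : stalkIdeal (vanishingIdeal B) x = Ideal.span {b₀}) :
    a₀ ∈ augIdeal (τ g) ∨ b₀ ∈ augIdeal (τ g) := by
  rcases stalkIdeal_le_augIdeal_or_of_subset_union σ p x a τ hkey hτ g hg hgx hZ A B hAB with h | h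
  · exact Or.inl (h (ha ▸ Ideal.mem_span_singleton_self a₀))
  · exact Or.inr (h (hb ▸ Ideal.mem_span_singleton_self b₀))

/-- **Relative form along an equivariant morphism**: if downstairs `Z_⟨g⟩(Y) ⊆ D` and upstairs `π⁻¹ D ⊆ A ∪ B`
(the total transform of the old boundary divisor `D` is carried by the closed sets `A`, `B` — strict transform and
exceptional divisor), then at every `x` with `g ∈ I_x` tame and regular stalk, `I(A)_x ≤ 𝔞_{τ g}` or
`I(B)_x ≤ 𝔞_{τ g}` (✓`inertLocus_subset_preimage`). [folklore] -/
theorem stalkIdeal_le_augIdeal_or_of_preimage_subset_union {Y : Scheme.{0}} (ρ : G →* Aut Y) (π : X ⟶ Y)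
    (hequiv : ∀ g : G, (σ g).hom ≫ π = π ≫ (ρ g).hom) (g : I) (hg : (orderOf g).Coprime p)
    (hgx : (g : G) ∈ inertiaSubgroup σ x)
    (hZ : IsClosed {y : X | Subgroup.zpowers (g : G) ≤ inertiaSubgroup σ y}) (D : Set Y)
    (hD : {y : Y | Subgroup.zpowers (g : G) ≤ inertiaSubgroup ρ y} ⊆ D) (A B : Closeds X)
    (hAB : π.base ⁻¹' D ⊆ (A : Set X) ∪ B) :
    stalkIdeal (vanishingIdeal A) x ≤ augIdeal (τ g) ∨ stalkIdeal (vanishingIdeal B) x ≤ augIdeal (τ g) :=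
  stalkIdeal_le_augIdeal_or_of_subset_union σ p x a τ hkey hτ g hg hgx hZ A B fun _ hy =>
    hAB (hD (inertLocus_subset_preimage σ ρ π hequiv _ hy))

end Union

/-! ## The character dichotomy for a stable boundary line -/

section Dichotomy

variable {R : Type*} [CommRing R] [IsLocalRing R] {K : Type*} [Group K] (τ : K →* (R ≃+* R))

/-- **Trivial character or inside the fixed locus.** Let `z ∈ 𝔪` generate an ideal `(z)` stable under the action
`τ` of `K` on the nose (`τ g z ∈ (z)` for all `g`). Then EITHER every `g ∈ K` acts trivially on the line `κ z̄` to
first order (`τ g z − z ∈ 𝔪²`) OR `z` lies in the fixed-locus ideal `⨆ g, 𝔞_{τ g}` of `K` (some `g` has scalar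
`≢ 1`, and then `z = (u − 1)⁻¹ (τ g z − z)`, ✓`mem_augIdeal_of_apply_eq_mul`). [folklore] -/
theorem sub_mem_sq_or_mem_iSup_augIdeal {z : R} (hz : z ∈ maximalIdeal R)
    (hstab : ∀ g : K, τ g z ∈ Ideal.span {z}) :
    (∀ g : K, τ g z - z ∈ maximalIdeal R ^ 2) ∨ z ∈ ⨆ g : K, augIdeal (τ g) := by
  by_cases h : ∀ g : K, ∃ u : R, u * z = τ g z ∧ u - 1 ∈ maximalIdeal R
  · left
    intro g
    obtain ⟨u, hu, hu1⟩ := h g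
    have e : τ g z - z = (u - 1) * z := by rw [← hu]; ring
    rw [e, pow_two]
    exact Ideal.mul_mem_mul hu1 hz
  · right
    push Not at h
    obtain ⟨g, hg⟩ := h
    obtain ⟨u, hu⟩ := Ideal.mem_span_singleton'.mp (hstab g)
    have hu1 : IsUnit (u - 1) := by
      by_contra hnu
      exact hg u hu ((IsLocalRing.mem_maximalIdeal _).mpr hnu)
    exact Submodule.mem_iSup_of_mem g (TameFixedLocus.mem_augIdeal_of_apply_eq_mul (τ g) hu.symm hu1)

/-- The same for a single element: `(z)` stable under `σ` ⇒ `σ z − z ∈ 𝔪²` or `z ∈ 𝔞_σ`. [folklore] -/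
theorem sub_mem_sq_or_mem_augIdeal (σ : R ≃+* R) {z : R} (hz : z ∈ maximalIdeal R)
    (hstab : σ z ∈ Ideal.span {z}) : σ z - z ∈ maximalIdeal R ^ 2 ∨ z ∈ augIdeal σ := by
  obtain ⟨u, hu⟩ := Ideal.mem_span_singleton'.mp hstab
  by_cases hu1 : u - 1 ∈ maximalIdeal R
  · left
    have e : σ z - z = (u - 1) * z := by rw [← hu]; ring
    rw [e, pow_two]
    exact Ideal.mul_mem_mul hu1 hz
  · right
    exact TameFixedLocus.mem_augIdeal_of_apply_eq_mul σ hu.symm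
      ((IsLocalRing.mem_maximalIdeal _).not.mp hu1 |> not_not.mp)

end Dichotomy

end Summit.ResolutionOfSingularities.ResolutionOfSingularities.Theorems.WildQuotientResolution.StandardForm

end
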